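import Summits.QuantumFields.YangMills.Theses.ScalingWindowSplit
import Literature.MathematicalPhysics.QuantumLattice.WilsonFeynmanHellmann
import Literature.MathematicalPhysics.QuantumLattice.GaugeGroups

/-!
# Sketch — crux-ideate `stmt-QuantumFields-18944` (`ScalingWindowSplit.SelfNormalisedSkewness`, W₂),
# ideator 2, round 1: first lemmas of the two idea cards

* card `superweak-abelian-laplace` (negation lens): `WitnessU1` — a `U(1)` super-weak-coupling scheme meeting
  every hypothesis of the crux along which the self-normalised skewness tends to `0` for EVERY disjoint triple;
  `not_selfNormalisedSkewness_of_witnessU1 : WitnessU1 → ¬ SelfNormalisedSkewness` (pure logic, proved here).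
* card `running-gap-sum-rule` (transfer, for the gapped core C′): `LocalResponseIdentity` (exact, provable now from
  `hasDerivAt_covariance_tilted`) and the transfer target `ResponseGrowth` (C⁺ ⇒ C′ by the window's RP
  log-convexity), plus `LambdaFloor`.

Only existing declarations are used; nothing here is an item.
-/

noncomputable section

open scoped BigOperators Topology
open Filter Set MeasureTheory ProbabilityTheory
open Literature.MathematicalPhysics.QuantumLattice Literature.MathematicalPhysics.AQFT
  Literature.MathematicalPhysics.QuantumFieldTheory

namespace Summit.QuantumFields.YangMills.Cruxes.SelfNormalisedSkewness.Ideator2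

/-- Euclidean `ℝ⁴`. -/
abbrev E4 : Type := EuclideanSpace ℝ (Fin 4)

section Vocabulary

variable {G : Type} [Group G] [TopologicalSpace G] [IsTopologicalGroup G] [CompactSpace G]
  [MeasurableSpace G] [BorelSpace G]

/-- The crux's BARE scheme (`c ≡ 1`, `m ≡ 0`). -/
def bare (sch : SpeciesScheme (YMSpecies G)) : SpeciesScheme (YMSpecies G) :=
  { sch with c := fun _ _ => 1, m := fun _ _ => 0 }

/-- The crux's `T w k`: bare truncated plaquette two-point function at the reflected pair `(w, θw)`. -/
def Tbare (r : LatticeRep G) (sch : SpeciesScheme (YMSpecies G)) (w : SchwartzMap E4 ℝ) (k : ℕ) : ℝ :=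
  latticeSchwinger r.ρ (bare sch) (fun s => s.F) k (1 + 1) (fun _ => r.curvature) ![w, thetaTest 4 w] -
    latticeSchwinger r.ρ (bare sch) (fun s => s.F) k 1 (fun _ => r.curvature) ![w] *
      latticeSchwinger r.ρ (bare sch) (fun s => s.F) k 1 (fun _ => r.curvature) ![thetaTest 4 w]

/-- The crux's SELF-NORMALISED scheme `canon` (`c'_k = 1/√T_k(u)`, `m'_k = ⟨F⟩_k`). -/
def canon (r : LatticeRep G) (sch : SpeciesScheme (YMSpecies G)) (u : SchwartzMap E4 ℝ) :
    SpeciesScheme (YMSpecies G) :=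
  { sch with c := fun _ k => (Real.sqrt (Tbare r sch u k))⁻¹,
             m := fun _ k => ∫ U, r.curvature.F (torusLift (sch.side k) U) ∂(wilsonMeasure r.ρ (sch.β k)) }

/-- The crux's self-normalised third cumulant `κ₃^canon_k(f, g, h)`. -/
def kappa3 (r : LatticeRep G) (sch : SpeciesScheme (YMSpecies G)) (u f g h : SchwartzMap E4 ℝ)
    (k : ℕ) : ℝ :=
  let S : (n : ℕ) → (Fin n → SchwartzMap E4 ℝ) → ℝ :=
    fun n w => latticeSchwinger r.ρ (canon r sch u) (fun s => s.F) k n (fun _ => r.curvature) w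
  S 3 ![f, g, h] - S 1 ![f] * S 2 ![g, h] - S 1 ![g] * S 2 ![f, h] - S 1 ![h] * S 2 ![f, g] +
    2 * (S 1 ![f] * S 1 ![g] * S 1 ![h])

/-- The crux's hypothesis block: weak coupling, polynomial volumes, past support of `u`,
floor ∧ window at `u`. -/
def Hyps (r : LatticeRep G) (sch : SpeciesScheme (YMSpecies G)) (u : SchwartzMap E4 ℝ) (p : ℕ)
    (M : ℝ) : Prop :=
  sch.HasWeakCouplingLimit ∧
    (∃ N : ℕ, 1 ≤ N ∧ ∀ᶠ k in atTop, (sch.a k)⁻¹ ≤ (sch.a k * (sch.L k : ℝ)) ^ N) ∧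
      tsupport u ⊆ {y : E4 | y 0 < 0} ∧
        ∀ᶠ k in atTop, (sch.a k) ^ p ≤ Tbare r sch u k ∧
          Tbare r sch u k ≤ M * Tbare r sch (timeShiftTest 4 (-1) u) k

/-- The canon field on ONE test function, as a function of the TORUS configuration at step `k`
(the integrand of `latticeSchwinger` for the scheme `canon`). -/
def fld (r : LatticeRep G) (sch : SpeciesScheme (YMSpecies G)) (u : SchwartzMap E4 ℝ) (k : ℕ)
    (w : SchwartzMap E4 ℝ) (U : GaugeConfig 4 (sch.side k) G) : ℝ :=
  smearedLatticeField r.curvature.F (Literature.Probability.LatticeModels.box 4 (sch.L k)) (sch.a k)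
    ((canon r sch u).c r.curvature k) ((canon r sch u).m r.curvature k) w (torusLift (sch.side k) U)

/-- `λ_k := a_k⁴ c'_k = a_k⁴ / √T_k(u)`: the factor converting a density-normalised (coupling-response)
insertion into a self-normalised one; `≍ 1` iff `tr F²` scales canonically at the window pair. -/
def lam (r : LatticeRep G) (sch : SpeciesScheme (YMSpecies G)) (u : SchwartzMap E4 ℝ) (k : ℕ) : ℝ :=
  (sch.a k) ^ 4 * (Real.sqrt (Tbare r sch u k))⁻¹

end Vocabulary

/-! ## Card `running-gap-sum-rule`: first lemma (exact local coupling response) and the transfer target -/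

/-- **First lemma (P-L1, provable now): the local Feynman–Hellmann / coupling-response identity in crux
vocabulary.** Tilting Wilson's measure at step `k` by `t · Φ^canon_k(g)` (= shifting the coupling on the
plaquette at `z` by `t · λ_k · g(a_k z)`) and differentiating the connected two-point function of
`Φ^canon_k(f), Φ^canon_k(h)` at `t = 0` gives EXACTLY the crux's third cumulant `κ₃^canon_k(f, g, h)`
(written in moments). One application of the tree's `hasDerivAt_covariance_tilted` (all three fields are
bounded on the compact torus configuration space). -/
def LocalResponseIdentity : Prop :=
  ∀ (G : Type) [Group G] [TopologicalSpace G] [IsTopologicalGroup G] [CompactSpace G]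
    [MeasurableSpace G] [BorelSpace G] (r : LatticeRep G) (sch : SpeciesScheme (YMSpecies G))
    (u f g h : SchwartzMap E4 ℝ) (k : ℕ),
    let μ : Measure (GaugeConfig 4 (sch.side k) G) := wilsonMeasure (d := 4) (L := sch.side k) r.ρ (sch.β k)
    let F := fld r sch u k f
    let Gi := fld r sch u k g
    let H := fld r sch u k h
    HasDerivAt (fun t : ℝ => cov[F, H; μ.tilted (fun U => t * Gi U)])
      ((∫ U, F U * Gi U * H U ∂μ) - (∫ U, F U ∂μ) * (∫ U, Gi U * H U ∂μ) -
        (∫ U, Gi U ∂μ) * (∫ U, F U * H U ∂μ) - (∫ U, H U ∂μ) * (∫ U, F U * Gi U ∂μ) +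
          2 * ((∫ U, F U ∂μ) * (∫ U, Gi U ∂μ) * (∫ U, H U ∂μ))) 0

/-- **Transfer target C⁺ (P-L2): linear growth of the slab response with the separation.** There are a slab
test function `g` supported in the open unit time-slab `|y₀| < 1/2` and a rate `ρ > 0` and an overlap constant
`C` such that for every extra separation `j` (time units), eventually in `k`, the first-order response of the
self-normalised two-point function of the pair `(τ₋ⱼ₋₁u, θτ₋ⱼ₋₁u)` to the local coupling shift `t · Φ^canon_k(g)`
is at least `(ρ (j+1) − C)` times that two-point function. Spectrally (RP transfer matrix + Feynman–Hellmann)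
this is "the energy levels carrying the spectral weight of `Φ(u)Ω` (a fixed fraction of it lies in the band
`[Δ, E*]` at bounded momentum, by gap + window + `u ∈ 𝓢`) run DOWN under a local increase of `β` at rate
`−∂ε_i ≥ ρ'·(aΔ)²/ε_i` — the `⟨p|θ|p⟩ = m²/E` form factor; one-sided, non-perturbative asymptotic freedom of
the gap" plus a bounded overlap response; by the exact
identity `LocalResponseIdentity` the left side IS `κ₃^canon_k(τ₋ⱼ₋₁u, g, θτ₋ⱼ₋₁u)`, and by RP log-convexity
the window gives `Cov_k(τ₋ⱼ₋₁u, θτ₋ⱼ₋₁u) ≥ M^{-(j+1)}`, so C⁺ at one fixed large `j` yields the floor of C′. -/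
def ResponseGrowth : Prop :=
  ∀ (G : Type) [Group G] [TopologicalSpace G] [IsTopologicalGroup G] [CompactSpace G]
    [MeasurableSpace G] [BorelSpace G] (r : LatticeRep G) (sch : SpeciesScheme (YMSpecies G))
    (u : SchwartzMap E4 ℝ) (p : ℕ) (M Δ : ℝ),
    Hyps r sch u p M → 0 < Δ → HasLatticeMassGap r sch Δ →
      ∃ (g : SchwartzMap E4 ℝ) (ρ C : ℝ), tsupport g ⊆ {y : E4 | |y 0| < 1 / 2} ∧ 0 < ρ ∧
        ∀ j : ℕ, ∀ᶠ k in atTop,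
          let μ : Measure (GaugeConfig 4 (sch.side k) G) :=
            wilsonMeasure (d := 4) (L := sch.side k) r.ρ (sch.β k)
          let v := timeShiftTest 4 (-((j : ℝ) + 1)) u
          let F := fld r sch u k v
          let H := fld r sch u k (thetaTest 4 v)
          let Gi := fld r sch u k g
          (ρ * ((j : ℝ) + 1) - C) * cov[F, H; μ] ≤
            |deriv (fun t : ℝ => cov[F, H; μ.tilted (fun U => t * Gi U)]) 0|

/-- **λ-floor (P-L3): canonical UV dimension of `tr F²` at the window pair** — `λ_k = a_k⁴/√T_k(u)` stays
bounded below, i.e. the bare truncated plaquette two-point function at physical separation is `O(a_k⁸)`.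
Needed to turn a density-normalised running statement into the self-normalised `ResponseGrowth`. -/
def LambdaFloor : Prop :=
  ∀ (G : Type) [Group G] [TopologicalSpace G] [IsTopologicalGroup G] [CompactSpace G]
    [MeasurableSpace G] [BorelSpace G] (r : LatticeRep G) (sch : SpeciesScheme (YMSpecies G))
    (u : SchwartzMap E4 ℝ) (p : ℕ) (M Δ : ℝ),
    Hyps r sch u p M → 0 < Δ → HasLatticeMassGap r sch Δ →
      ∃ lam₀ : ℝ, 0 < lam₀ ∧ ∀ᶠ k in atTop, lam₀ ≤ lam r sch u k

/-! ## Card `superweak-abelian-laplace`: the `U(1)` super-weak-coupling witness and the pure-logic kill -/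

/-- Borel structure on `U(1) = Circle` (as the summit statement supplies it for every `G`). -/
@[reducible] def circleMeasurableSpace : MeasurableSpace Circle := borel Circle

attribute [local instance] circleMeasurableSpace

theorem circle_borelSpace : BorelSpace Circle := ⟨rfl⟩

attribute [local instance] circle_borelSpace

/-- **First lemma of the negation line (N-L1): the super-weak abelian witness.** For `G = U(1)` with a faithful
unitary lattice representation `r` there are a scheme `sch` (intended: `a_k = 1/(k+2)`, `L_k = ⌈a_k⁻²⌉`,
`β_k = a_k^{-s}` with `s` large — "super-weak": `β_k ≥ side_k^C`), a past-supported bump `u`, an exponent `p`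
and a window constant `M` such that ALL hypotheses of the crux hold (weak coupling, PolyVolume, floor, window —
from the lattice-Maxwell leading asymptotics `T_k(w) = ¼β_k⁻² Q_k(w)`, `Q_k(w) → Q(w) > 0`) while for EVERY
pairwise disjoint triple `f, g, h` the self-normalised skewness `κ₃^canon_k(f,g,h) → 0` (the Gaussian 3-ring
tends to its continuum value, which is `0` by `Negative.treeLevelSkewness_vanishes`; anharmonic corrections are
relatively `O(β_k⁻¹·poly(side_k)) → 0`). -/
def WitnessU1 : Prop :=
  ∃ (r : LatticeRep Circle) (sch : SpeciesScheme (YMSpecies Circle)) (u : SchwartzMap E4 ℝ) (p : ℕ)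
    (M : ℝ), Hyps r sch u p M ∧
      ∀ f g h : SchwartzMap E4 ℝ, Disjoint (tsupport f) (tsupport g) → Disjoint (tsupport f) (tsupport h) →
        Disjoint (tsupport g) (tsupport h) → Tendsto (kappa3 r sch u f g h) atTop (𝓝 0)

/-- **The kill is pure logic once the witness is in hand**: `WitnessU1 → ¬ W₂`. (Instantiate the crux at
`G = Circle` and the witness data; its `δ`-floor contradicts `κ₃ → 0`.) -/
theorem not_selfNormalisedSkewness_of_witnessU1 (hW : WitnessU1) :
    ¬ Summit.QuantumFields.YangMills.Theses.ScalingWindowSplit.SelfNormalisedSkewness := by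
  intro hS
  obtain ⟨r, sch, u, p, M, ⟨hweak, hvol, hsupp, hfw⟩, hlim⟩ := hW
  have h := hS Circle r sch u p M hweak hvol hsupp hfw
  obtain ⟨f, g, h3, δ, hfg, hfh, hgh, hδ, hev⟩ := h
  have hev' : ∀ᶠ k in atTop, δ ≤ |kappa3 r sch u f g h3 k| := hev
  have hsmall : ∀ᶠ k in atTop, |kappa3 r sch u f g h3 k| < δ := by
    have ht := hlim f g h3 hfg hfh hgh
    have := (Metric.tendsto_nhds.1 ht) δ hδ
    refine this.mono fun k hk => ?_
    simpa [Real.dist_eq] using hk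
  obtain ⟨k, hk₁, hk₂⟩ := (hev'.and hsmall).exists
  exact absurd hk₁ (not_le.2 hk₂)

end Summit.QuantumFields.YangMills.Cruxes.SelfNormalisedSkewness.Ideator2

end
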